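import Summits.ResolutionOfSingularities.ResolutionOfSingularities.Theorems.SubfieldContactCofinite
import Summits.ResolutionOfSingularities.ResolutionOfSingularities.Theorems.SubfieldContactPowAdjoin
import Summits.ResolutionOfSingularities.ResolutionOfSingularities.Theorems.SubfieldContactSpreads
import HarnessLib

/-!
# SubfieldContactStalk — decomp-res node «SubfieldContact» (lens-6), generation 20, tree file 2/2 of the KERNEL PROOF of
`SubfieldContactAbs` (window-g20 item (M1), CRITIC-LEDGER rows 147b/147c/147d): PIECE L1-abs `StalkSubfieldContactAbs`
PROVED, the lemma `SubfieldContactAbs` / `SubfieldContact` PROVED IN KERNEL, hypothesis-free cone edges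

WRITER PROVENANCE (decomp-res-writer-1 g8): VERBATIM from `HOME/decomp-res-lens-6/g20/tree/SubfieldContactStalk.lean`
(sha256 11a9f94e…; PIN 2026-08-30T23:22:49Z), CRITIC-LEDGER row 152 CLEARED (lens-6 g20 MAP +1 (M1)); writer changes =
file-level linter option dropped, docstring wraps. Supports stmt-ResolutionOfSingularities-26971; the in-cone
`MaxContactCutSubfieldContactStalk` proves item 26970's decl.

= §12c–§12f of the node file `HOME/decomp-res-lens-6/g20/SubfieldContactStalk.lean` (HOME = run/shared/lean/pub/decomp-res),
split for the 400-line limit; cone-free (imports the landed node files + file 1/2 `SubfieldContactCofinite`); namespace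
of the node.  In-cone wiring (MaxContactCut items BY NAME): `MaxContactCutSubfieldContactStalk`.

* §12c `exists_adapted_pIndependent_superset` (Zorn inside `κ(k)` with a prescribed `p`-independent start) and
  `exists_isQFrame_containing` — generation 18's frame theorem `isQFrame_frobSubring` with the frame ring `R^{p^e}[b]`
  CONTAINING a prescribed set of constants `Λk ⊆ k` whose residues are `p`-independent in the residue field.
* §12d Lemma A `exists_mem_diffIdeal_of_isQFrame_sub` (ring level): a `p^{N+1}`-frame whose ring contains the image of a
  field `F₀` gives `F₀`-LINEAR contact for every ideal `J ⊆ 𝔪^{N+1}`, `J ⊄ 𝔪^{N+2}` that is not a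
`p`-power form (the
  truncated Taylor morphism of the frame is `Cq`-linear, hence an `F₀`-algebra map; its coefficients form a truncated
  Hasse–Schmidt system over `F₀`; lens-4's `exists_hasse_apply_of_not_mem_pPowerSpan` /
  `exists_hasse_apply_mem_and_notMem_sq` pick the coefficient of order `≤ N` landing in `𝔪 ∖ 𝔪²`).  Lemma B
  `exists_isQFrame_containing_pBasis` (scheme level): at a CLOSED point of an `IsBase` datum the frame can be chosen to
  contain `κ(B ∖ S₀)` for the cofinite exceptional set `S₀` of §12b applied to the finite extension `κ(y) ⊇ k`.
* §12e `stalkSubfieldContactAbs_of_cofinitePIndep`, **`stalkSubfieldContactAbs_holds : StalkSubfieldContactAbs`** (PIECE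
  L1-abs), and through the landed `subfieldContactAbs_of_pieces''` (pieces F, C: `SubfieldContactPowAdjoin`; L2:
  `SubfieldContactSpreads`) **`subfieldContactAbs_holds : SubfieldContactAbs`**, `subfieldContact_holds : SubfieldContact`,
  `stalkSubfieldContact_holds`.
* §12f HYPOTHESIS-FREE CONE EDGES: `e1NoSubDvd_iff_e1TopNoAbs'`, `worNoSubDvd_iff_worTopNoAbs'`, `worNoSub_iff_dvd'`,
  `e1NoSub_iff_dvd'`, `worOn_not_dvd_of_five'`, `worAllAbs_of_five'`, `e_one_iff_noSubDvd'`, `e_one_iff_topNoAbs'`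
  (`E 5 ⟹ (E 1 ↔ E1NoSubDvd ↔ E1TopNoAbs)`), `wor_three_off3'`, `worPure_three_of_five_and_on3'`.

Every top point of EVERY weak-order-reduction datum `(Y → Spec k, 𝓘, n)` over EVERY field `k` of characteristic `p` that
has absolute stalk contact has contact over ONE subfield `F ⊆ k` of finite codegree (`Y/F` still separated, lft, qc):
maximal contact in the sense of the tree's `IsContactPt` EXISTS over imperfect fields exactly where it exists
absolutely, in particular at EVERY top point when `p ∤ n`.

(Sources: Matsumura1987 §26, Thm 30.6; EGAIV4 §16.8; Giraud1975; CossartPiltant2008I Thm 2.1;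
Cossart2011WeakMaximalContact; Kollar2007 §3.9.)
-/

noncomputable section

open CategoryTheory AlgebraicGeometry TopologicalSpace
open Literature.AlgebraicGeometry.Resolution
open Summit.ResolutionOfSingularities.ResolutionOfSingularities.Theorems
open WeakOrderReduction ForcedTowerClasses PurityValveClasses
open IsLocalRing MvPolynomial
open AbsoluteContactClasses (IsAbsContactAt SepResidueAt diffIdeal_restrict_le stalkMap_comp_toStalk_eq_stalkHom
  IsQFrame boxMon taylorMon uMon uMon_eq_eval hsCoeff_uMon module_finite_residueField_of_isClosed
  pcl mem_pcl_of_mem_adjoin forall_mem_pcl_pow exists_finset_span_pcl exists_finset_span_pcl_pow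
  qIndep_of_isPIndependent QIndep frobSubring genSubring pow_mem_frobSubring apply_mem_frobSubring
  frobSubring_le_genSubring pow_mem_genSubring isQFrame_frobSubring)
open HugValuationCut (PPowerFormAt not_isAbsContactAt_of_pPowerFormAt essFiniteType_stalk
  stalkIdeal_le_and_not_le_of_idealOrder isUnit_natCast_of_not_dvd exists_hasse_apply_of_not_mem_pPowerSpan
  exists_hasse_apply_mem_and_notMem_sq)
open scoped BigOperators
namespace Summit.ResolutionOfSingularities.ResolutionOfSingularities.Theorems.SubfieldContactClasses

/-! ### §12c Adapted `p`-independent generating set with a PRESCRIBED `p`-independent part; frames containing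
prescribed constants -/

section FieldLayer

variable {K : Type*} [Field K] (p : ℕ) [Fact p.Prime] [CharP K p]

/-- Zorn with a prescribed start: as `exists_adapted_pIndependent`, with `Λ ⊇ Λ₁` for a given `p`-independent
`Λ₁ ⊆ k̄`. [folklore] -/
theorem exists_adapted_pIndependent_superset (k : Type*) [Field k] [Algebra k K] {Λ₁ : Set K}
    (hΛ₁k : Λ₁ ⊆ Set.range (algebraMap k K))
    (hΛ₁i : IsPIndependent (F := ↥(frobenius K p).fieldRange) p Λ₁) :
    ∃ Λ T : Set K, Λ₁ ⊆ Λ ∧ Λ ⊆ Set.range (algebraMap k K) ∧ Λ ⊆ T ∧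
      IsPIndependent (F := ↥(frobenius K p).fieldRange) p T ∧
      (∀ x : K, x ∈ IntermediateField.adjoin (↥(frobenius K p).fieldRange) T) ∧
      ∀ a : k, algebraMap k K a ∈ IntermediateField.adjoin (↥(frobenius K p).fieldRange) Λ := by
  classical
  have hexp : ∀ x : K, x ^ p ∈ (algebraMap (↥(frobenius K p).fieldRange) K).range := fun x =>
    ⟨⟨x ^ p, RingHom.mem_fieldRange.mpr ⟨x, frobenius_def ..⟩⟩, rfl⟩
  obtain ⟨Λ, hΛ₁Λ, hΛ⟩ := zorn_subset_nonempty
    {S : Set K | S ⊆ Set.range (algebraMap k K) ∧ IsPIndependent (F := ↥(frobenius K p).fieldRange) p S}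
    (fun c hc hchain _ => ⟨⋃₀ c, ⟨Set.sUnion_subset fun s hs => (hc hs).1,
      isPIndependent_sUnion_of_isChain hchain fun s hs => (hc hs).2⟩,
      fun s hs => Set.subset_sUnion_of_mem hs⟩) Λ₁ ⟨hΛ₁k, hΛ₁i⟩
  have hΛk : Λ ⊆ Set.range (algebraMap k K) := hΛ.prop.1
  have hΛi : IsPIndependent (F := ↥(frobenius K p).fieldRange) p Λ := hΛ.prop.2
  obtain ⟨T, hΛT, hT⟩ := zorn_subset_nonempty
    {S : Set K | IsPIndependent (F := ↥(frobenius K p).fieldRange) p S}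
    (fun c hc hchain _ => ⟨⋃₀ c, isPIndependent_sUnion_of_isChain hchain fun s hs => hc hs,
      fun s hs => Set.subset_sUnion_of_mem hs⟩) Λ hΛi
  refine ⟨Λ, T, hΛ₁Λ, hΛk, hΛT, hT.prop, fun x => ?_, fun a => ?_⟩
  · by_contra hx
    have hins := isPIndependent_insert hT.prop hx (hexp x)
    have hxT : x ∉ T := fun h => hx (IntermediateField.subset_adjoin _ _ h)
    exact hxT (hT.mem_of_prop_insert hins)
  · by_contra ha
    have hins := isPIndependent_insert hΛi ha (hexp _)
    have haΛ : algebraMap k K a ∉ Λ := fun h => ha (IntermediateField.subset_adjoin _ _ h)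
    exact haΛ (hΛ.mem_of_prop_insert ⟨Set.insert_subset ⟨a, rfl⟩ hΛk, hins⟩)

end FieldLayer

section Frame

/-- `hasQFrames` with a prescribed `p`-independent set of constants inside the frame ring: if `Λk ⊆ k` has
`p`-independent image over `K^p` in the residue field `K`, there is an absolute `p^e`-frame `Cq = R^{p^e}[b]`
with `κ(Λk) ⊆ Cq` (choose the adapted `p`-independent set `Λ ⊇ κ̄(Λk)` and the lifts through `k`). [folklore] -/
theorem exists_isQFrame_containing (p : ℕ) [Fact p.Prime] (k : Type) [Field k] [CharP k p] (R : Type) [CommRing R]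
    [Algebra k R] [IsRegularLocalRing R] [Algebra.EssFiniteType k R] [Module.Finite k (ResidueField R)]
    {d : ℕ} (u : Fin d → R) (hd : (maximalIdeal R).spanFinrank = d) (hu : Ideal.span (Set.range u) = maximalIdeal R)
    (e : ℕ) (he : 0 < e) (Λk : Set k)
    (hind : haveI : CharP (ResidueField R) p :=
        charP_of_injective_algebraMap (algebraMap k (ResidueField R)).injective p
      IsPIndependent (F := ↥(frobenius (ResidueField R) p).fieldRange) p (algebraMap k (ResidueField R) '' Λk)) :
    ∃ Cq : Subring R, IsQFrame (p ^ e) Cq u ∧ ∀ x ∈ Λk, algebraMap k R x ∈ Cq := by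
  classical
  have hp : p.Prime := Fact.out
  obtain ⟨e', rfl⟩ : ∃ e', e = e' + 1 := ⟨e - 1, by omega⟩
  haveI : CharP R p := charP_of_injective_algebraMap (algebraMap k R).injective p
  haveI : CharP (ResidueField R) p :=
    charP_of_injective_algebraMap (algebraMap k (ResidueField R)).injective p
  have hκK : ∀ a : k, algebraMap k (ResidueField R) a = residue R (algebraMap k R a) := fun a => by
    rw [IsScalarTower.algebraMap_apply k R (ResidueField R)]; rfl
  -- field layer: an adapted `p`-independent generating set `Λ ⊆ T` of the residue field, `Λ ⊇ κ̄(Λk)`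
  obtain ⟨Λ, T, hΛ₁Λ, hΛk, hΛT, hTi, hTgen, hΛgen⟩ := exists_adapted_pIndependent_superset p
    (K := ResidueField R) k (Λ₁ := algebraMap k (ResidueField R) '' Λk)
    (by rintro _ ⟨x, -, rfl⟩; exact ⟨x, rfl⟩) hind
  -- lifts `b : T → R`, through `k` on `Λ`
  have hlift : ∀ ξ : ↥T, ∃ r : R, residue R r = ξ ∧
      ((ξ : ResidueField R) ∈ Λ → ∃ a : k, algebraMap k (ResidueField R) a = ξ ∧ r = algebraMap k R a) := by
    intro ξ
    by_cases hξ : (ξ : ResidueField R) ∈ Λ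
    · obtain ⟨a, ha⟩ := hΛk hξ
      exact ⟨algebraMap k R a, by rw [← hκK, ha], fun _ => ⟨a, ha, rfl⟩⟩
    · obtain ⟨r, hr⟩ := residue_surjective (R := R) ξ
      exact ⟨r, hr, fun h => absurd h hξ⟩
  choose b hb hbΛ using hlift
  have hbval : (fun i : ↥T => residue R (b i)) = Subtype.val := funext hb
  -- (i) independence of the residues
  have hT : QIndep (p ^ (e' + 1)) (fun i => residue R (b i)) := by
    rw [hbval]
    exact QIndep.pow_level p (qIndep_of_isPIndependent p hTi) (e' + 1)
  -- (ii) generation of the residue field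
  have hK : ∀ ξ : ResidueField R, ξ ∈ Subring.closure
      ((fun y : ResidueField R => y ^ p ^ (e' + 1)) '' Set.univ ∪ Set.range (fun i => residue R (b i))) := by
    rw [hbval, Subtype.range_coe]
    exact forall_mem_pcl_pow p T (fun x => mem_pcl_of_mem_adjoin p T (hTgen x)) (e' + 1) (Nat.succ_pos e')
  -- (iii) the coefficient field is finitely generated over `Sq`
  obtain ⟨M₁, hM₁⟩ := exists_finset_span_pcl p k hΛk hΛgen
  obtain ⟨M, hM⟩ := exists_finset_span_pcl_pow p k _ M₁ hM₁ e'
  have hΛS : ∀ x : k, algebraMap k (ResidueField R) x ∈ Λ → algebraMap k R x ∈ frobSubring p (e' + 1) b := by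
    intro x hx
    have hxT : algebraMap k (ResidueField R) x ∈ T := hΛT hx
    obtain ⟨a, ha, hba⟩ := hbΛ ⟨_, hxT⟩ hx
    have hax : a = x := (algebraMap k (ResidueField R)).injective ha
    rw [← hax, ← hba]
    exact apply_mem_frobSubring p (e' + 1) b ⟨_, hxT⟩
  have hΛ₀S : ∀ c ∈ pcl (p ^ (e' + 1)) ((algebraMap k (ResidueField R)) ⁻¹' Λ),
      algebraMap k R c ∈ genSubring p (e' + 1) b u := by
    intro c hc
    refine (Subring.closure_le (t := (genSubring p (e' + 1) b u).comap (algebraMap k R))).mpr ?_ hc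
    rintro x (⟨y, -, rfl⟩ | hx)
    · rw [SetLike.mem_coe, Subring.mem_comap, map_pow]; exact pow_mem_genSubring p (e' + 1) b u _
    · rw [SetLike.mem_coe, Subring.mem_comap]
      exact frobSubring_le_genSubring p (e' + 1) b u (hΛS x hx)
  have hk : ∃ Mk : Finset R, ∀ a : k,
      algebraMap k R a ∈ Submodule.span (↥(genSubring p (e' + 1) b u)) (Mk : Set R) := by
    refine ⟨M.image (algebraMap k R), fun a => ?_⟩
    obtain ⟨f, -, hf⟩ := Submodule.mem_span_finset.mp (hM a)
    rw [← hf, map_sum]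
    refine Submodule.sum_mem _ fun m hm => ?_
    rw [Subring.smul_def, smul_eq_mul, map_mul]
    have : algebraMap k R (f m : k) * algebraMap k R m =
        (⟨algebraMap k R (f m : k), hΛ₀S _ (f m).2⟩ : ↥(genSubring p (e' + 1) b u)) • algebraMap k R m := rfl
    rw [this]
    exact Submodule.smul_mem _ _ (Submodule.subset_span (Finset.mem_coe.mpr (Finset.mem_image_of_mem _ hm)))
  exact ⟨frobSubring p (e' + 1) b, isQFrame_frobSubring p (e' + 1) b hd u hu k hT hK hk,
    fun x hx => hΛS x (hΛ₁Λ ⟨x, hx, rfl⟩)⟩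

end Frame

/-! ### §12d–§12e Lemma A (ring level), Lemma B (scheme level) and the assembly -/

section Assembly

/-- **Lemma A (ring level, KERNEL): a `p^{N+1}`-frame containing the scalars gives `F₀`-LINEAR contact.** `S` a local
ring of characteristic `p` with an `F₀`-algebra structure whose image lies in the frame ring `Cq` of an absolute
`p^{N+1}`-frame at generators `u` of `𝔪`; `J ⊆ 𝔪^{N+1}`, `J ⊄ 𝔪^{N+2}`, not a `p`-power form ⟹
`Diff^{≤N}_{S/F₀}(J)` meets `𝔪 ∖ 𝔪²` (the truncated Taylor morphism of the frame is `Cq`-linear, hence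
`F₀`-linear; its
coefficients form a Hasse–Schmidt system over `F₀`; lens-4's `exists_hasse_apply_*`). [folklore] -/
theorem exists_mem_diffIdeal_of_isQFrame_sub {F₀ : Type} [Field F₀] {S : Type} [CommRing S] [IsLocalRing S]
    [Algebra F₀ S] {p : ℕ} [hpF : Fact p.Prime] [CharP S p] {N d : ℕ} {u : Fin d → S}
    (hu : Ideal.span (Set.range u) = maximalIdeal S) {Cq : Subring S} (hF : IsQFrame (p ^ (N + 1)) Cq u)
    (hsub : ∀ c : F₀, algebraMap F₀ S c ∈ Cq) {J : Ideal S} (hJ1 : J ≤ maximalIdeal S ^ (N + 1))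
    (hJ2 : ¬ J ≤ maximalIdeal S ^ (N + 2))
    (hJ3 : ¬ (p ∣ N + 1 ∧
      J ≤ Ideal.span ((fun h : S => h ^ p) '' ↑(maximalIdeal S ^ ((N + 1) / p))) ⊔ maximalIdeal S ^ (N + 2))) :
    ∃ x ∈ diffIdeal F₀ N J, x ∈ maximalIdeal S ∧ x ∉ maximalIdeal S ^ 2 := by
  classical
  have hp : p.Prime := Fact.out
  have hq : N + 1 < p ^ (N + 1) := Nat.lt_pow_self hp.one_lt
  have hq0 : 0 < p ^ (N + 1) := pow_pos hp.pos _
  -- the truncated Taylor morphism of the frame is `F₀`-linear (`F₀ ⊆ Cq` and `T` is `Cq`-linear)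
  let Q := MvPolynomial (Fin d) S ⧸ idealOfVars (Fin d) S ^ (p ^ (N + 1))
  let ψ0 : S →+* Q := hF.taylorHom p (N + 1) rfl
  have hψC : ∀ x ∈ Cq, hF.taylorLinQ x = Ideal.Quotient.mk _ (C x) := by
    intro x hx
    have hone : (1 : S) = boxMon (p ^ (N + 1)) u (fun _ => ⟨0, hq0⟩) := by simp [boxMon]
    have hT1 : hF.taylorLin 1 = 1 := by
      rw [hone, hF.taylorLin_boxMon]; simp [taylorMon]
    have h1 := hF.taylorLin.map_smul (⟨x, hx⟩ : Cq) (1 : S)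
    rw [hT1, Subring.smul_def, Subring.smul_def, smul_eq_mul, mul_one, smul_eq_C_mul, mul_one] at h1
    rw [hF.taylorLinQ_apply, h1]
  let ψ : S →ₐ[F₀] Q :=
    { ψ0 with
      commutes' := fun c => by
        show hF.taylorLinQ (algebraMap F₀ S c) = algebraMap F₀ Q c
        rw [hψC _ (hsub c), IsScalarTower.algebraMap_apply F₀ S Q]
        rfl }
  have hψ0 : ∀ b, TruncPoly.truncCoeff S (Fin d) (p ^ (N + 1)) 0 (ψ b) = b :=
    hF.truncCoeff_zero_taylorHom p (N + 1) rfl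
  have hψu : ∀ i, ψ0.toIntAlgHom (u i) = Ideal.Quotient.mk _ (C (u i) + X i) := hF.taylorHom_u p (N + 1) rfl
  -- its coefficients: a truncated Hasse–Schmidt system of level `N + 1` along `u`, scalars `F₀`
  let Δ : (Fin d →₀ ℕ) → (S →ₗ[F₀] S) := fun α => TruncPoly.hsCoeff (p ^ (N + 1)) ψ α
  have h0 : ∀ b, Δ 0 b = b := hψ0
  have hL : ∀ α : Fin d →₀ ℕ, α.degree ≤ N + 1 → ∀ f f' : S,
      Δ α (f * f') = ∑ c ∈ Finset.HasAntidiagonal.antidiagonal α, Δ c.1 f * Δ c.2 f' :=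
    fun α hα f f' => TruncPoly.hsCoeff_mul ψ (lt_of_le_of_lt hα hq) f f'
  have hV : ∀ α β : Fin d →₀ ℕ, α.degree ≤ N + 1 →
      Δ α (∏ i, u i ^ β i) = ((∏ i ∈ α.support, (β i).choose (α i) : ℕ) : S) * ∏ i, u i ^ (β - α) i := by
    intro α β hα
    have h1 : Δ α (∏ i, u i ^ β i) = TruncPoly.hsCoeff (p ^ (N + 1)) ψ0.toIntAlgHom α (uMon u β) := rfl
    rw [h1, hsCoeff_uMon ψ0.toIntAlgHom u hψu β α (lt_of_le_of_lt hα hq), hasseDeriv_monomial, map_mul,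
      map_natCast, ← uMon_eq_eval]
    rfl
  have hD : ∀ (e : ℕ) (α : Fin d →₀ ℕ), α.degree ≤ e → e ≤ N + 1 → IsDiffOpLE F₀ e (Δ α) :=
    isDiffOpLE_of_hasseSystem F₀ h0 hL
  have hunit : ∀ m : ℕ, ¬ p ∣ m → IsUnit ((m : ℕ) : S) := fun m hm => isUnit_natCast_of_not_dvd m hm
  have conclude : ∀ {f : S}, f ∈ J → ∀ q : Fin d →₀ ℕ, q.degree = N → Δ q f ∈ maximalIdeal S →
      Δ q f ∉ maximalIdeal S ^ 2 → ∃ x ∈ diffIdeal F₀ N J, x ∈ maximalIdeal S ∧ x ∉ maximalIdeal S ^ 2 :=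
    fun {f} hf q hqd h1 h2 => ⟨Δ q f, apply_mem_diffIdeal F₀ (hD N q hqd.le (Nat.le_succ N)) hf, h1, h2⟩
  by_cases hpN : p ∣ N + 1
  · obtain ⟨f, hfJ, hf2⟩ : ∃ f ∈ J, f ∉ Ideal.span ((fun h : S => h ^ p) '' ↑(maximalIdeal S ^ ((N + 1) / p))) ⊔
        maximalIdeal S ^ (N + 2) := by
      by_contra hcon
      push Not at hcon
      exact hJ3 ⟨hpN, hcon⟩
    obtain ⟨q, hqd, hm1, hm2⟩ :=
      exists_hasse_apply_of_not_mem_pPowerSpan hu h0 hL hV hD hp hunit (hJ1 hfJ) hf2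
    exact conclude hfJ q hqd hm1 hm2
  · obtain ⟨f, hfJ, hf2⟩ : ∃ f ∈ J, f ∉ maximalIdeal S ^ (N + 2) := by
      by_contra hcon
      push Not at hcon
      exact hJ2 hcon
    obtain ⟨q, hqd, hm1, hm2⟩ := exists_hasse_apply_mem_and_notMem_sq hu h0 hL hV hD hunit hpN (hJ1 hfJ) hf2
    exact conclude hfJ q hqd hm1 hm2

/-- **Lemma B (scheme level, `k`-structure only): a frame at a closed point containing a cofinite part of the
`p`-basis**, stated with the EXPLICIT structure ring map `k → Γ(Y, 𝒪_Y) → 𝒪_{Y,y}`. [folklore] -/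
theorem exists_isQFrame_containing_pBasis (HW2 : ∀ p : ℕ, (hp : Fact p.Prime) → CofinitePIndep p)
    {p : ℕ} [Fact p.Prime] {k : Type} [Field k] [CharP k p] {Y : Scheme.{0}} (g : Y ⟶ Spec (.of k))
    (hB : IsBase Y g) (B : Set k) (hBasis : IsPBasis p k B) {y : Y} (hy : IsClosed ({y} : Set Y)) (e : ℕ)
    (he : 0 < e) :
    CharP (Y.presheaf.stalk y) p ∧ ∃ S₀ : Finset k, (↑S₀ : Set k) ⊆ B ∧
      ∃ u : Fin (maximalIdeal (Y.presheaf.stalk y)).spanFinrank → Y.presheaf.stalk y,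
        Ideal.span (Set.range u) = maximalIdeal _ ∧
        ∃ Cq : Subring (Y.presheaf.stalk y), IsQFrame (p ^ e) Cq u ∧
          ∀ x ∈ B \ ↑S₀, ((Y.presheaf.germ ⊤ y trivial).hom.comp
            (g.appTop.hom.comp (Scheme.ΓSpecIso (.of k)).inv.hom)) x ∈ Cq := by
  haveI : LocallyOfFiniteType g := hB.locallyOfFiniteType
  let S := Y.presheaf.stalk y
  letI algkS : Algebra k S := stalkAlgebra (g.appTop.hom.comp (Scheme.ΓSpecIso (.of k)).inv.hom) y
  haveI : Algebra.EssFiniteType k S := essFiniteType_stalk g y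
  haveI : IsRegularLocalRing S := hB.isRegular y
  haveI : Module.Finite k (ResidueField S) := module_finite_residueField_of_isClosed g hy
  haveI hchar : CharP S p := charP_of_injective_algebraMap (algebraMap k S).injective p
  haveI : CharP (ResidueField S) p := charP_of_injective_algebraMap (algebraMap k (ResidueField S)).injective p
  obtain ⟨S₀, hS₀B, hind⟩ := HW2 p inferInstance k (ResidueField S) B hBasis
  obtain ⟨u, hu⟩ := exists_regularSystemOfParameters (R := S)
  obtain ⟨Cq, hF, hCqB⟩ := exists_isQFrame_containing p k S u rfl hu e he (B \ ↑S₀) hind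
  exact ⟨hchar, S₀, hS₀B, u, hu, Cq, hF, hCqB⟩

/-- **KERNEL: `CofinitePIndep p` for all primes `p` ⟹ `StalkSubfieldContactAbs`.** [folklore] -/
theorem stalkSubfieldContactAbs_of_cofinitePIndep (HW2 : ∀ p : ℕ, (hp : Fact p.Prime) → CofinitePIndep p) :
    StalkSubfieldContactAbs := by
  intro p hp n hn k _ _ Y g hB I B hBasis y hy hord hAbs
  classical
  haveI : Fact p.Prime := ⟨hp⟩
  obtain ⟨N, rfl⟩ : ∃ N, n = N + 1 := ⟨n - 1, by omega⟩
  obtain ⟨hle, hnle⟩ := stalkIdeal_le_and_not_le_of_idealOrder I y hord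
  obtain ⟨hchar, S₀, hS₀B, u, hu, Cq, hF, hCqB⟩ :=
    exists_isQFrame_containing_pBasis HW2 g hB B hBasis hy (N + 1) (Nat.succ_pos N)
  haveI := hchar
  -- absolute contact ⟹ not a `p`-power form (lens-4 g23, contrapositive)
  have hnpp : ¬ PPowerFormAt p I (N + 1) y := fun h => not_isAbsContactAt_of_pPowerFormAt (Nat.succ_pos N) h hAbs
  refine ⟨S₀, hS₀B, ?_⟩
  have hq0 : 0 < p ^ (N + 1) := pow_pos hp.pos _
  -- the structure subfield `F' = k^{p^{N+1}}(B ∖ S₀)` and ITS algebra structure on the stalk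
  let F' : Subfield k := powAdjoin k (p ^ (N + 1)) (B \ ↑S₀)
  let S := Y.presheaf.stalk y
  letI algF'S : Algebra F' S :=
    stalkAlgebra ((strOver g F').appTop.hom.comp (Scheme.ΓSpecIso (.of F')).inv.hom) y
  have hF'Cq : ∀ c : F', algebraMap F' S c ∈ Cq := by
    intro c
    have hφ := appTop_comp_specMap F'.subtype g
    have e1 : algebraMap F' S = (Y.presheaf.germ ⊤ y trivial).hom.comp
        ((g ≫ Spec.map (CommRingCat.ofHom F'.subtype)).appTop.hom.comp (Scheme.ΓSpecIso (.of F')).inv.hom) :=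
      rfl
    rw [e1, hφ, ← RingHom.comp_assoc, RingHom.comp_apply]
    exact map_powAdjoin_subset _ hq0 (B \ ↑S₀) Cq (fun s => hF.pow_mem s) hCqB c c.2
  obtain ⟨x, hx, hx1, hx2⟩ :=
    exists_mem_diffIdeal_of_isQFrame_sub (F₀ := F') hu hF hF'Cq (J := stalkIdeal I y) hle hnle hnpp
  exact ⟨x, by rw [Nat.add_sub_cancel]; exact hx, hx1, hx2⟩

/-- **PIECE L1-abs PROVED (KERNEL, hypothesis-free, standard axioms): `StalkSubfieldContactAbs`.** [folklore] -/
theorem stalkSubfieldContactAbs_holds : StalkSubfieldContactAbs :=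
  stalkSubfieldContactAbs_of_cofinitePIndep fun p _ => cofinitePIndep_holds p

end Assembly

/-! ## §12e (continued) THE LEMMA `SubfieldContactAbs` PROVED IN KERNEL (pieces L1-abs, F, L2, C by name) -/

/-- **`SubfieldContactAbs` PROVED (KERNEL, hypothesis-free, standard axioms)** — every weak-order-reduction datum over
every field of characteristic `p` whose CLOSED top points all have absolute stalk contact has subfield contact:
`subfieldContactAbs_of_pieces''` (tree, `SubfieldContactPowAdjoin`: PIECE F `powAdjoinBase_holds` and PIECE C
`subfieldContactGlue_holds` inside) fired on PIECE L1-abs `stalkSubfieldContactAbs_holds` (this file) and PIECE L2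
`contactSpreads_holds` (tree, `SubfieldContactSpreads`). [folklore] -/
theorem subfieldContactAbs_holds : SubfieldContactAbs :=
  subfieldContactAbs_of_pieces'' stalkSubfieldContactAbs_holds contactSpreads_holds

/-- **`SubfieldContact` PROVED (KERNEL)**: for `p ∤ n`, every datum over every field of characteristic `p` has subfield
contact (`subfieldContact_of_abs`). [folklore] -/
theorem subfieldContact_holds : SubfieldContact :=
  subfieldContact_of_abs subfieldContactAbs_holds

/-- PIECE L1 (coprime form) PROVED: `stalkSubfieldContact_of_abs`. [folklore] -/
theorem stalkSubfieldContact_holds : StalkSubfieldContact :=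
  stalkSubfieldContact_of_abs stalkSubfieldContactAbs_holds

/-! ## §12f HYPOTHESIS-FREE CONE EDGES (the node's kernels with the lemma discharged) -/

/-- **EXACT, hypothesis-free**: the located wild residual of `E 1` in the no-subfield-contact typing IS the residual in
the absolute-stalk-contact typing: `E1NoSubDvd ↔ E1TopNoAbs`. [folklore] -/
theorem e1NoSubDvd_iff_e1TopNoAbs' : E1NoSubDvd ↔ E1TopNoAbs :=
  e1NoSubDvd_iff_e1TopNoAbs subfieldContactAbs_holds

/-- weightwise form of `e1NoSubDvd_iff_e1TopNoAbs'`. [folklore] -/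
theorem worNoSubDvd_iff_worTopNoAbs' {n : ℕ} (hn : 1 ≤ n) : WORNoSubDvd n ↔ WORTopNoAbs n :=
  worNoSubDvd_iff_worTopNoAbs subfieldContactAbs_holds hn

/-- **hypothesis-free**: the COPRIME slices of the no-subfield-contact class are EMPTY over every field — weak order
reduction for data without subfield contact reduces to the markings divisible by `p`. [folklore] -/
theorem worNoSub_iff_dvd' {n : ℕ} (hn : 1 ≤ n) : WORNoSub n ↔ WORNoSubDvd n :=
  worNoSub_iff_dvd subfieldContact_holds hn

/-- sequence form of `worNoSub_iff_dvd'`. [folklore] -/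
theorem e1NoSub_iff_dvd' : E1NoSub ↔ E1NoSubDvd :=
  e1NoSub_iff_dvd subfieldContact_holds

/-- **hypothesis-free CONE EDGE**: `SeqDimFour 5 n` (weak order reduction for data WITH contact over the structure
field, quantified over all fields) gives weak order reduction at EVERY marking `n` with `p ∤ n` over EVERY field of
characteristic `p` — N33's rungs hold at every coprime marking over imperfect fields too. [folklore] -/
theorem worOn_not_dvd_of_five' {n : ℕ} (hn : 1 ≤ n) (h5 : SeqDimFour 5 n) : WOROn (fun p => ¬ p ∣ n) n :=
  worOn_not_dvd_of_five subfieldContact_holds hn h5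

/-- **hypothesis-free**: `SeqDimFour 5 n` gives weak order reduction for every datum all of whose closed top points
have absolute stalk contact (any marking, any field). [folklore] -/
theorem worAllAbs_of_five' {n : ℕ} (hn : 1 ≤ n) (h5 : SeqDimFour 5 n) : WORAllAbs n :=
  worAllAbs_of_five subfieldContactAbs_holds hn h5

/-- **hypothesis-free CONE EDGE**: modulo `E 5` alone, `E 1 ↔ E1NoSubDvd`. [folklore] -/
theorem e_one_iff_noSubDvd' (h5 : E 5) : E 1 ↔ E1NoSubDvd :=
  e_one_iff_noSubDvd subfieldContact_holds h5

/-- **hypothesis-free CONE EDGE (THE RE-LOCATION OF THE HOST)**: modulo `E 5` alone, `E 1 ↔ E1TopNoAbs` — weak order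
reduction in dimension four reduces EXACTLY to the data having a CLOSED top point WITHOUT absolute stalk contact
(`p ∣ n` forced: `dvd_of_topNoAbsContact`; ≡ `p`-power form: `ContactFreeIsPPower`). [folklore] -/
theorem e_one_iff_topNoAbs' (h5 : E 5) : E 1 ↔ E1TopNoAbs :=
  e_one_iff_topNoAbs subfieldContactAbs_holds h5

/-- **hypothesis-free**: at marking `3`, `SeqDimFour 5 3` gives weak order reduction in every characteristic `p ≠ 3`.
[folklore] -/
theorem wor_three_off3' (h5 : SeqDimFour 5 3) : WOROn (· ≠ 3) 3 :=
  wor_three_off3 subfieldContact_holds h5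

/-- **hypothesis-free**: the `p ≠ 3` half of `WORPure 3` from `SeqDimFour 5 3`; with the `p = 3` column it gives
`WORPure 3`. [folklore] -/
theorem worPure_three_of_five_and_on3' (h5 : SeqDimFour 5 3) (h3 : WORPureOn (· = 3) 3) : WORPure 3 :=
  worPure_three_of_five_and_on3 subfieldContact_holds h5 h3

end Summit.ResolutionOfSingularities.ResolutionOfSingularities.Theorems.SubfieldContactClasses

end
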